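import Summits.QuantumFields.YangMills.Theorems.ColdStartUniversalityLatticeLangevinGaussShiftVec
import HarnessLib

/-!
# Route `ColdStartUniversality`, crux K_A1 `UniformColdStartMixing` (stmt-QuantumFields-24809), rung `stub_fixedCutoffMixing`:
# E-block brick 3 — the discrete Girsanov formula on the product Gaussian space

Helper file (seat `ym-line-csu-p1`, g7).  On `Ω_n = (ℝ^d)^n` with the product Gaussian `μ_n = ⊗_{i<n} gaussVec d h` (the law
of `n` Brownian increments of variance `h`), let `Θ_i : Ω_n → ℝ^d` be bounded, measurable and PREDICTABLE (`Θ_i(x)` depends on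
`x_0, …, x_{i-1}` only), `T(x)_i = x_i - h Θ_i(x)` the shifted increments and
`Z(x) = ∏_i exp(Θ_i(x)·x_i - h|Θ_i(x)|²/2)` the Girsanov weight.  Then for every bounded measurable `G`,

  `∫ G(T x) Z(x) dμ_n(x) = ∫ G dμ_n`   (`integral_comp_shift_mul_girsanovWeight`),

by induction on `n`, peeling the last increment with `measurePreserving_piFinSuccAbove` and the `d`-dimensional shift identity
`integral_mul_exp_gaussVec_eq_integral_add`.  For Euler schemes `X^h = Ψ(ξ)` (drift `b₀ + σθ`) and `Y^h = Ψ(Tξ)` (drift `b₀`,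
`Θ_i = θ(Y^h_i)`) this reads `E F(X^h) = E[F(Y^h) Z]` — the E-block's step 3.  No definition, no sorry.  RECORD-rung R3
plumbing; nothing here bears on the mass gap.
-/

set_option autoImplicit false

noncomputable section

namespace Summit.QuantumFields.YangMills.Theorems.ColdStartUniversality

open MeasureTheory ProbabilityTheory Filter Finset
open scoped NNReal ENNReal BigOperators
open Literature.Probability.Process (gaussVec)

/-- `x ↦ exp(R Σ_k |x_k|)`-type domination: `∏_k exp(R |x_k|)` is integrable for `gaussVec d h`. [folklore] -/
theorem integrable_prod_exp_mul_abs_gaussVec (d : ℕ) (h : ℝ≥0) (R : ℝ) :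
    Integrable (fun x : Fin d → ℝ => ∏ k, Real.exp (R * |x k|)) (gaussVec d h) := by
  unfold gaussVec
  exact Integrable.fintype_prod (f := fun _ (t : ℝ) => Real.exp (R * |t|)) fun _ => integrable_exp_mul_abs_gaussianReal 0 h R

/-- The one-increment Girsanov factor is dominated: `exp(θ·y - h|θ|²/2) ≤ ∏_k exp(R |y_k|)` when `|θ_k| ≤ R`. [folklore] -/
theorem exp_dot_sub_le_prod_exp {d : ℕ} {h : ℝ≥0} {R : ℝ} {θ : Fin d → ℝ} (hθ : ∀ k, |θ k| ≤ R) (y : Fin d → ℝ) :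
    Real.exp (∑ k, θ k * y k - (h : ℝ) * (∑ k, θ k ^ 2) / 2) ≤ ∏ k, Real.exp (R * |y k|) := by
  rw [← Real.exp_sum, Real.exp_le_exp]
  have h1 : ∑ k, θ k * y k ≤ ∑ k, R * |y k| := Finset.sum_le_sum fun k _ => by
    calc θ k * y k ≤ |θ k * y k| := le_abs_self _
      _ = |θ k| * |y k| := abs_mul _ _
      _ ≤ R * |y k| := mul_le_mul_of_nonneg_right (hθ k) (abs_nonneg _)
  have h2 : 0 ≤ (h : ℝ) * (∑ k, θ k ^ 2) / 2 := by positivity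
  linarith

/-- **The discrete Girsanov formula.**  On `((Fin d → ℝ))^n` with the product Gaussian `⊗ gaussVec d h` (`h > 0`): for predictable
bounded measurable `Θ` and bounded measurable `G`,
`∫ G(x - h Θ(x)) ∏_i exp(Θ_i(x)·x_i - h|Θ_i(x)|²/2) dμ = ∫ G dμ`. [folklore] -/
theorem integral_comp_shift_mul_girsanovWeight : ∀ (n d : ℕ) {h : ℝ≥0} (_ : h ≠ 0)
    (Θ : Fin n → (Fin n → (Fin d → ℝ)) → (Fin d → ℝ)) (_ : ∀ i, Measurable (Θ i)) {R : ℝ} (_ : ∀ i x k, |Θ i x k| ≤ R)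
    (_ : ∀ (i : Fin n) (x x' : Fin n → (Fin d → ℝ)), (∀ j, j < i → x j = x' j) → Θ i x = Θ i x')
    {G : (Fin n → (Fin d → ℝ)) → ℝ} (_ : Measurable G) {C : ℝ} (_ : ∀ x, |G x| ≤ C),
    ∫ x, G (fun i k => x i k - (h : ℝ) * Θ i x k) *
        ∏ i, Real.exp (∑ k, Θ i x k * x i k - (h : ℝ) * (∑ k, Θ i x k ^ 2) / 2)
        ∂(Measure.pi fun _ : Fin n => gaussVec d h) =
      ∫ x, G x ∂(Measure.pi fun _ : Fin n => gaussVec d h) := by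
  intro n
  induction n with
  | zero =>
    intro d h hh Θ hΘm R hR hpred G hG C hC
    refine integral_congr_ae (Eventually.of_forall fun x => ?_)
    have hx : (fun i k => x i k - (h : ℝ) * Θ i x k) = x := funext fun i => Fin.elim0 i
    simp [hx]
  | succ n ih =>
    intro d h hh Θ hΘm R hR hpred G hG C hC
    haveI : IsProbabilityMeasure (gaussVec d h) := by unfold gaussVec; infer_instance
    have hC0 : 0 ≤ C := (abs_nonneg _).trans (hC 0)
    -- notation
    set γ : Measure (Fin d → ℝ) := gaussVec d h with hγ
    set μ' : Measure (Fin n → (Fin d → ℝ)) := Measure.pi fun _ : Fin n => gaussVec d h with hμ'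
    haveI : IsProbabilityMeasure μ' := by rw [hμ']; infer_instance
    -- split off the last increment: `x = Fin.snoc x' y`
    set e := MeasurableEquiv.piFinSuccAbove (fun _ : Fin (n + 1) => Fin d → ℝ) (Fin.last n) with he
    have hmp : MeasurePreserving e (Measure.pi fun _ : Fin (n + 1) => gaussVec d h) (γ.prod μ') :=
      measurePreserving_piFinSuccAbove (fun _ : Fin (n + 1) => gaussVec d h) (Fin.last n)
    have hsymm : ∀ p : (Fin d → ℝ) × (Fin n → (Fin d → ℝ)),
        e.symm p = (Fin.snoc p.2 p.1 : Fin (n + 1) → (Fin d → ℝ)) := by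
      intro p
      rw [he, MeasurableEquiv.piFinSuccAbove_symm_apply]
      exact Fin.insertNth_last' p.1 p.2
    have hL : ∀ F : (Fin (n + 1) → (Fin d → ℝ)) → ℝ, ∫ x, F x ∂(Measure.pi fun _ : Fin (n + 1) => gaussVec d h) =
        ∫ p, F (Fin.snoc p.2 p.1) ∂(γ.prod μ') := by
      intro F
      rw [← hmp.symm.integral_comp' (f := e.symm) F]
      simp_rw [hsymm]
    have hsnoc_meas : Measurable fun p : (Fin d → ℝ) × (Fin n → (Fin d → ℝ)) =>
        (Fin.snoc p.2 p.1 : Fin (n + 1) → (Fin d → ℝ)) := by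
      have : (fun p : (Fin d → ℝ) × (Fin n → (Fin d → ℝ)) => (Fin.snoc p.2 p.1 : Fin (n + 1) → (Fin d → ℝ))) = e.symm :=
        funext fun p => (hsymm p).symm
      rw [this]; exact e.symm.measurable
    have hsnoc0 : Measurable fun x' : Fin n → (Fin d → ℝ) => (Fin.snoc x' (0 : Fin d → ℝ) : Fin (n + 1) → (Fin d → ℝ)) :=
      hsnoc_meas.comp (measurable_const.prodMk measurable_id)
    -- the reduced predictable family and the last coefficient
    set Θ' : Fin n → (Fin n → (Fin d → ℝ)) → (Fin d → ℝ) := fun i x' => Θ i.castSucc (Fin.snoc x' 0) with hΘ'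
    set θn : (Fin n → (Fin d → ℝ)) → (Fin d → ℝ) := fun x' => Θ (Fin.last n) (Fin.snoc x' 0) with hθn
    have hagree : ∀ (x' : Fin n → (Fin d → ℝ)) (y : Fin d → ℝ) (j : Fin (n + 1)), j < Fin.last n →
        (Fin.snoc x' y : Fin (n + 1) → (Fin d → ℝ)) j = (Fin.snoc x' (0 : Fin d → ℝ) : Fin (n + 1) → (Fin d → ℝ)) j := by
      intro x' y j hj
      have hne : j ≠ Fin.last n := Fin.lt_last_iff_ne_last.1 hj
      rw [← Fin.castSucc_castPred j hne, Fin.snoc_castSucc, Fin.snoc_castSucc]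
    have hcast : ∀ (i : Fin n) (x' : Fin n → (Fin d → ℝ)) (y : Fin d → ℝ), Θ i.castSucc (Fin.snoc x' y) = Θ' i x' :=
      fun i x' y => hpred _ _ _ fun j hj => hagree x' y j (lt_trans hj (Fin.castSucc_lt_last i))
    have hlast : ∀ (x' : Fin n → (Fin d → ℝ)) (y : Fin d → ℝ), Θ (Fin.last n) (Fin.snoc x' y) = θn x' :=
      fun x' y => hpred _ _ _ fun j hj => hagree x' y j hj
    have hΘ'm : ∀ i, Measurable (Θ' i) := fun i => (hΘm _).comp hsnoc0
    have hθnm : Measurable θn := (hΘm _).comp hsnoc0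
    have hΘ'R : ∀ i x k, |Θ' i x k| ≤ R := fun i x k => hR _ _ _
    have hθnR : ∀ x k, |θn x k| ≤ R := fun x k => hR _ _ _
    have hΘ'pred : ∀ (i : Fin n) (x x' : Fin n → (Fin d → ℝ)), (∀ j, j < i → x j = x' j) → Θ' i x = Θ' i x' := by
      intro i x x' hxx'
      refine hpred _ _ _ fun j hj => ?_
      have hne : j ≠ Fin.last n := Fin.lt_last_iff_ne_last.1 (lt_trans hj (Fin.castSucc_lt_last i))
      rw [← Fin.castSucc_castPred j hne, Fin.snoc_castSucc, Fin.snoc_castSucc]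
      exact hxx' _ (by rw [← Fin.castSucc_lt_castSucc_iff, Fin.castSucc_castPred]; exact hj)
    -- the integrand at `snoc x' y`
    have hT : ∀ (x' : Fin n → (Fin d → ℝ)) (y : Fin d → ℝ),
        (fun i k => (Fin.snoc x' y : Fin (n + 1) → (Fin d → ℝ)) i k - (h : ℝ) * Θ i (Fin.snoc x' y) k) =
        Fin.snoc (fun i k => x' i k - (h : ℝ) * Θ' i x' k) (fun k => y k - (h : ℝ) * θn x' k) := by
      intro x' y
      funext i
      refine Fin.lastCases ?_ (fun i' => ?_) i
      · funext k; rw [Fin.snoc_last, hlast, Fin.snoc_last]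
      · funext k; rw [Fin.snoc_castSucc, hcast, Fin.snoc_castSucc]
    have hZ : ∀ (x' : Fin n → (Fin d → ℝ)) (y : Fin d → ℝ),
        ∏ i, Real.exp (∑ k, Θ i (Fin.snoc x' y) k * (Fin.snoc x' y : Fin (n + 1) → (Fin d → ℝ)) i k -
          (h : ℝ) * (∑ k, Θ i (Fin.snoc x' y) k ^ 2) / 2) =
        (∏ i : Fin n, Real.exp (∑ k, Θ' i x' k * x' i k - (h : ℝ) * (∑ k, Θ' i x' k ^ 2) / 2)) *
          Real.exp (∑ k, θn x' k * y k - (h : ℝ) * (∑ k, θn x' k ^ 2) / 2) := by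
      intro x' y
      rw [Fin.prod_univ_castSucc]
      simp only [Fin.snoc_castSucc, Fin.snoc_last, hcast, hlast]
    -- pass to the product space
    rw [hL, hL]
    simp_rw [hT, hZ]
    -- integrability
    have hW_int : Integrable (fun p : (Fin d → ℝ) × (Fin n → (Fin d → ℝ)) =>
        (∏ k, Real.exp (R * |p.1 k|)) * ∏ i, ∏ k, Real.exp (R * |p.2 i k|)) (γ.prod μ') := by
      have hB : Integrable (fun z : Fin n → (Fin d → ℝ) => ∏ i, ∏ k, Real.exp (R * |z i k|)) μ' := by
        rw [hμ']
        exact Integrable.fintype_prod (f := fun (_ : Fin n) (z : Fin d → ℝ) => ∏ k, Real.exp (R * |z k|))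
          fun _ => integrable_prod_exp_mul_abs_gaussVec d h R
      exact Integrable.mul_prod (integrable_prod_exp_mul_abs_gaussVec d h R) hB
    have hZ'le : ∀ x' : Fin n → (Fin d → ℝ),
        ∏ i : Fin n, Real.exp (∑ k, Θ' i x' k * x' i k - (h : ℝ) * (∑ k, Θ' i x' k ^ 2) / 2) ≤
          ∏ i, ∏ k, Real.exp (R * |x' i k|) :=
      fun x' => Finset.prod_le_prod (fun i _ => (Real.exp_pos _).le) fun i _ => exp_dot_sub_le_prod_exp (fun k => hΘ'R i x' k) (x' i)
    have hmeasF : Measurable fun p : (Fin d → ℝ) × (Fin n → (Fin d → ℝ)) =>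
        G (Fin.snoc (fun i k => p.2 i k - (h : ℝ) * Θ' i p.2 k) (fun k => p.1 k - (h : ℝ) * θn p.2 k)) *
        ((∏ i : Fin n, Real.exp (∑ k, Θ' i p.2 k * p.2 i k - (h : ℝ) * (∑ k, Θ' i p.2 k ^ 2) / 2)) *
          Real.exp (∑ k, θn p.2 k * p.1 k - (h : ℝ) * (∑ k, θn p.2 k ^ 2) / 2)) := by
      have hy : Measurable fun p : (Fin d → ℝ) × (Fin n → (Fin d → ℝ)) => fun k => p.1 k - (h : ℝ) * θn p.2 k := by
        refine measurable_pi_lambda _ fun k => ?_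
        have h1 : Measurable fun p : (Fin d → ℝ) × (Fin n → (Fin d → ℝ)) => p.1 k := (measurable_pi_apply k).comp measurable_fst
        have h2 : Measurable fun p : (Fin d → ℝ) × (Fin n → (Fin d → ℝ)) => θn p.2 k :=
          (measurable_pi_apply k).comp (hθnm.comp measurable_snd)
        exact h1.sub (h2.const_mul _)
      have hx' : Measurable fun p : (Fin d → ℝ) × (Fin n → (Fin d → ℝ)) => fun i k => p.2 i k - (h : ℝ) * Θ' i p.2 k := by
        refine measurable_pi_lambda _ fun i => measurable_pi_lambda _ fun k => ?_
        have h1 : Measurable fun p : (Fin d → ℝ) × (Fin n → (Fin d → ℝ)) => p.2 i k :=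
          (measurable_pi_apply k).comp ((measurable_pi_apply i).comp measurable_snd)
        have h2 : Measurable fun p : (Fin d → ℝ) × (Fin n → (Fin d → ℝ)) => Θ' i p.2 k :=
          (measurable_pi_apply k).comp ((hΘ'm i).comp measurable_snd)
        exact h1.sub (h2.const_mul _)
      have hGc : Measurable fun p : (Fin d → ℝ) × (Fin n → (Fin d → ℝ)) =>
          G (Fin.snoc (fun i k => p.2 i k - (h : ℝ) * Θ' i p.2 k) (fun k => p.1 k - (h : ℝ) * θn p.2 k)) :=
        hG.comp (hsnoc_meas.comp (hy.prodMk hx'))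
      refine hGc.mul (Measurable.mul (Finset.measurable_prod _ fun i _ => Real.measurable_exp.comp ?_) (Real.measurable_exp.comp ?_))
      · have ha : ∀ k, Measurable fun p : (Fin d → ℝ) × (Fin n → (Fin d → ℝ)) => Θ' i p.2 k := fun k =>
          (measurable_pi_apply k).comp ((hΘ'm i).comp measurable_snd)
        have hb : ∀ k, Measurable fun p : (Fin d → ℝ) × (Fin n → (Fin d → ℝ)) => p.2 i k := fun k =>
          (measurable_pi_apply k).comp ((measurable_pi_apply i).comp measurable_snd)
        exact (Finset.measurable_sum _ fun k _ => (ha k).mul (hb k)).sub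
          (((Finset.measurable_sum _ fun k _ => (ha k).pow_const 2).const_mul _).div_const _)
      · have ha : ∀ k, Measurable fun p : (Fin d → ℝ) × (Fin n → (Fin d → ℝ)) => θn p.2 k := fun k =>
          (measurable_pi_apply k).comp (hθnm.comp measurable_snd)
        have hb : ∀ k, Measurable fun p : (Fin d → ℝ) × (Fin n → (Fin d → ℝ)) => p.1 k := fun k =>
          (measurable_pi_apply k).comp measurable_fst
        exact (Finset.measurable_sum _ fun k _ => (ha k).mul (hb k)).sub
          (((Finset.measurable_sum _ fun k _ => (ha k).pow_const 2).const_mul _).div_const _)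
    have hInt : Integrable (fun p : (Fin d → ℝ) × (Fin n → (Fin d → ℝ)) =>
        G (Fin.snoc (fun i k => p.2 i k - (h : ℝ) * Θ' i p.2 k) (fun k => p.1 k - (h : ℝ) * θn p.2 k)) *
        ((∏ i : Fin n, Real.exp (∑ k, Θ' i p.2 k * p.2 i k - (h : ℝ) * (∑ k, Θ' i p.2 k ^ 2) / 2)) *
          Real.exp (∑ k, θn p.2 k * p.1 k - (h : ℝ) * (∑ k, θn p.2 k ^ 2) / 2))) (γ.prod μ') := by
      refine (hW_int.const_mul C).mono' hmeasF.aestronglyMeasurable (Eventually.of_forall fun p => ?_)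
      rw [Real.norm_eq_abs, abs_mul, abs_of_nonneg (by positivity :
        (0:ℝ) ≤ (∏ i : Fin n, Real.exp (∑ k, Θ' i p.2 k * p.2 i k - (h : ℝ) * (∑ k, Θ' i p.2 k ^ 2) / 2)) *
          Real.exp (∑ k, θn p.2 k * p.1 k - (h : ℝ) * (∑ k, θn p.2 k ^ 2) / 2))]
      calc |G _| * ((∏ i : Fin n, Real.exp (∑ k, Θ' i p.2 k * p.2 i k - (h : ℝ) * (∑ k, Θ' i p.2 k ^ 2) / 2)) *
            Real.exp (∑ k, θn p.2 k * p.1 k - (h : ℝ) * (∑ k, θn p.2 k ^ 2) / 2))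
          ≤ C * ((∏ i, ∏ k, Real.exp (R * |p.2 i k|)) * ∏ k, Real.exp (R * |p.1 k|)) :=
            mul_le_mul (hC _) (mul_le_mul (hZ'le p.2) (exp_dot_sub_le_prod_exp (fun k => hθnR p.2 k) p.1) (Real.exp_pos _).le
              (by positivity)) (by positivity) hC0
        _ = C * ((∏ k, Real.exp (R * |p.1 k|)) * ∏ i, ∏ k, Real.exp (R * |p.2 i k|)) := by ring
    -- Fubini: integrate the last increment first
    rw [integral_prod_symm _ hInt]
    -- inner integral: the `d`-dimensional shift identity
    have hinner : ∀ x' : Fin n → (Fin d → ℝ),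
        ∫ y, G (Fin.snoc (fun i k => x' i k - (h : ℝ) * Θ' i x' k) (fun k => y k - (h : ℝ) * θn x' k)) *
          ((∏ i : Fin n, Real.exp (∑ k, Θ' i x' k * x' i k - (h : ℝ) * (∑ k, Θ' i x' k ^ 2) / 2)) *
            Real.exp (∑ k, θn x' k * y k - (h : ℝ) * (∑ k, θn x' k ^ 2) / 2)) ∂γ =
        (∏ i : Fin n, Real.exp (∑ k, Θ' i x' k * x' i k - (h : ℝ) * (∑ k, Θ' i x' k ^ 2) / 2)) *
          ∫ y, G (Fin.snoc (fun i k => x' i k - (h : ℝ) * Θ' i x' k) y) ∂γ := by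
      intro x'
      have hy1 : Measurable fun y : Fin d → ℝ => fun k => y k - (h : ℝ) * θn x' k :=
        measurable_pi_lambda _ fun k => (measurable_pi_apply k).sub_const _
      have hgm : Measurable fun y : Fin d → ℝ =>
          G (Fin.snoc (fun i k => x' i k - (h : ℝ) * Θ' i x' k) (fun k => y k - (h : ℝ) * θn x' k)) :=
        hG.comp (hsnoc_meas.comp (hy1.prodMk (measurable_const (a := fun i k => x' i k - (h : ℝ) * Θ' i x' k))))
      have h1 := integral_mul_exp_gaussVec_eq_integral_add d hh (θn x') hgm (C := C) (fun y => hC _)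
      rw [hγ]
      calc ∫ y, G (Fin.snoc (fun i k => x' i k - (h : ℝ) * Θ' i x' k) (fun k => y k - (h : ℝ) * θn x' k)) *
            ((∏ i : Fin n, Real.exp (∑ k, Θ' i x' k * x' i k - (h : ℝ) * (∑ k, Θ' i x' k ^ 2) / 2)) *
              Real.exp (∑ k, θn x' k * y k - (h : ℝ) * (∑ k, θn x' k ^ 2) / 2)) ∂(gaussVec d h)
          = (∏ i : Fin n, Real.exp (∑ k, Θ' i x' k * x' i k - (h : ℝ) * (∑ k, Θ' i x' k ^ 2) / 2)) *
            ∫ y, G (Fin.snoc (fun i k => x' i k - (h : ℝ) * Θ' i x' k) (fun k => y k - (h : ℝ) * θn x' k)) *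
              Real.exp (∑ k, θn x' k * y k - (h : ℝ) * (∑ k, θn x' k ^ 2) / 2) ∂(gaussVec d h) := by
            rw [← integral_const_mul]
            exact integral_congr_ae (Eventually.of_forall fun y => by ring)
        _ = _ := by
            rw [h1]
            congr 1
            refine integral_congr_ae (Eventually.of_forall fun y => ?_)
            simp only [add_sub_cancel_right]
    simp_rw [hinner]
    -- induction hypothesis with `G̃ z := ∫ G(snoc z y) dγ(y)`
    have hGt_m : Measurable fun z : Fin n → (Fin d → ℝ) => ∫ y, G (Fin.snoc z y) ∂γ := by
      have hm : Measurable (Function.uncurry fun (z : Fin n → (Fin d → ℝ)) (y : Fin d → ℝ) => G (Fin.snoc z y)) :=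
        hG.comp (hsnoc_meas.comp (measurable_snd.prodMk measurable_fst))
      exact (hm.stronglyMeasurable.integral_prod_right').measurable
    have hGt_C : ∀ z : Fin n → (Fin d → ℝ), |∫ y, G (Fin.snoc z y) ∂γ| ≤ C := by
      intro z
      have := norm_integral_le_of_norm_le_const (μ := γ) (f := fun y => G (Fin.snoc z y)) (C := C)
        (Eventually.of_forall fun y => by rw [Real.norm_eq_abs]; exact hC _)
      rw [Real.norm_eq_abs] at this; simpa using this
    have hIH := ih d hh Θ' hΘ'm hΘ'R hΘ'pred hGt_m hGt_C
    have hcomm : ∀ x' : Fin n → (Fin d → ℝ),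
        (∏ i : Fin n, Real.exp (∑ k, Θ' i x' k * x' i k - (h : ℝ) * (∑ k, Θ' i x' k ^ 2) / 2)) *
          ∫ y, G (Fin.snoc (fun i k => x' i k - (h : ℝ) * Θ' i x' k) y) ∂γ =
        (fun z : Fin n → (Fin d → ℝ) => ∫ y, G (Fin.snoc z y) ∂γ) (fun i k => x' i k - (h : ℝ) * Θ' i x' k) *
          ∏ i : Fin n, Real.exp (∑ k, Θ' i x' k * x' i k - (h : ℝ) * (∑ k, Θ' i x' k ^ 2) / 2) := fun x' => mul_comm _ _
    simp_rw [hcomm]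
    rw [hμ', hIH]
    -- reassemble
    have hInt2 : Integrable (fun p : (Fin d → ℝ) × (Fin n → (Fin d → ℝ)) => G (Fin.snoc p.2 p.1)) (γ.prod μ') :=
      Integrable.of_bound (hG.comp hsnoc_meas).aestronglyMeasurable C
        (Eventually.of_forall fun p => by rw [Real.norm_eq_abs]; exact hC _)
    rw [← hμ', ← integral_prod_symm _ hInt2]

end Summit.QuantumFields.YangMills.Theorems.ColdStartUniversality

end
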